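import Summits.ResolutionOfSingularities.ResolutionOfSingularities.Theorems.PurelyInseparableDim4PureLeafUnitOddThree
import Summits.ResolutionOfSingularities.ResolutionOfSingularities.Theorems.PurelyInseparableDim4PureLeafUnitOddPairRename
import Summits.ResolutionOfSingularities.ResolutionOfSingularities.Theorems.PurelyInseparableDim4PureLeafInertSquareRename
import Summits.ResolutionOfSingularities.ResolutionOfSingularities.Theorems.PurelyInseparableDim4PureLeafUnitPlainCensus
import HarnessLib
import HarnessLib.Audit.Tags

/-!
# Purely inseparable fourfolds — 47 of the 81 unit leaves `x^a(1+x₀)`, `a ∈ {1,2,3}⁴`, are instances of UNIFORM (every-size) plain-game theorems over `𝔽₂` ‖ K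
# (cell res-dim4-pi; brick (δ), CONFIGS (2,2) unit-leaf row, UNIFORM cell) [OURS · counted 0 · census corollary]

Width seat `res-dim4-p-10` (g5).  Bookkeeping corollary for the board: the unit census has 58 plain-won leaves (`…PureLeafUnitPlainCensus`,
p725918); 47 of them are the smallest members of infinite families covered by UNIFORM theorems of this lineage — cited, not restated:
* `a₀ = 2` (27): `PureLeafNF.stateWins_unitLeaf_even` (p702830); `1222`, `3222`: `PureLeafNF.stateWins_unitLeaf_odd_of_forall_even` (p703461);
* `a₀ ∈ {1, 3}` with exactly ONE odd partner (12): `PureLeafNF.stateWins_unitLeaf_oneOdd_partner` (p727199) /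
  `PureLeafNF.stateWins_unitLeaf_threeOdd_partner` (p727909) — «the reservoir cannot be cashed»;
* two odd partners `1, 1` and one even exponent (6): the INERT SQUARE `InertSquare.Orbit111/311.stateWins_unitLeaf_111_sq / _311_sq`
  (p728010) and their renamings `InertSquare.stateWins_unitLeaf_1sq11 / _11sq1 / _3sq11 / _31sq1` (`…InertSquareRename`).
The other 11 plain-won leaves (`1111`, `3111`, `1123 1132 1213 1231 1312 1321`, `1233 1323 1332`) are known by CERTIFICATE only, and the
23 of `UnitLeafPlain.plainOpen23` are plain-undecided (in-scope A-wins, p721457).  `uniformCensus47_subset`: the list is drawn from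
g4's `InScopeWinCert.unitCensus81`.

Riders: `𝔽₂`-rational replies; the PLAIN coordinate game of OUR frame v4 (`StateWins 2`), not MODE 1h, not CJS, not ∀K; nothing here
proves F4-C(2,2), `Terminates1h 2 2` or resolution of singularities in dimension ≥ 4 / characteristic `p`; counted 0; AI kernel work,
weaker than expert review. bears_on: LADDER-RESOLUTION:D157-DOOR2 (res-dim4-pi · brick (δ) · unit census, uniform cell).
Supports stmt-ResolutionOfSingularities-16155 (helper).
-/

set_option linter.dupNamespace false

open MvPolynomial

noncomputable section

namespace Summit.ResolutionOfSingularities.ResolutionOfSingularities.Theorems.PIDim4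

namespace UnitLeafPlain

open Literature.AlgebraicGeometry.Resolution

/-- The 47 exponent vectors of the unit census whose leaf is the smallest member of a uniformly-won infinite family (lexicographic).
[folklore] -/
def uniformCensus47 : List (Fin 4 → ℕ) := [
  ![1, 1, 1, 2], ![1, 1, 2, 1], ![1, 1, 2, 2], ![1, 2, 1, 1], ![1, 2, 1, 2], ![1, 2, 2, 1],
  ![1, 2, 2, 2], ![1, 2, 2, 3], ![1, 2, 3, 2], ![1, 3, 2, 2], ![2, 1, 1, 1], ![2, 1, 1, 2],
  ![2, 1, 1, 3], ![2, 1, 2, 1], ![2, 1, 2, 2], ![2, 1, 2, 3], ![2, 1, 3, 1], ![2, 1, 3, 2],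
  ![2, 1, 3, 3], ![2, 2, 1, 1], ![2, 2, 1, 2], ![2, 2, 1, 3], ![2, 2, 2, 1], ![2, 2, 2, 2],
  ![2, 2, 2, 3], ![2, 2, 3, 1], ![2, 2, 3, 2], ![2, 2, 3, 3], ![2, 3, 1, 1], ![2, 3, 1, 2],
  ![2, 3, 1, 3], ![2, 3, 2, 1], ![2, 3, 2, 2], ![2, 3, 2, 3], ![2, 3, 3, 1], ![2, 3, 3, 2],
  ![2, 3, 3, 3], ![3, 1, 1, 2], ![3, 1, 2, 1], ![3, 1, 2, 2], ![3, 2, 1, 1], ![3, 2, 1, 2],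
  ![3, 2, 2, 1], ![3, 2, 2, 2], ![3, 2, 2, 3], ![3, 2, 3, 2], ![3, 3, 2, 2] ]

/-- The list is drawn from g4's census list. [folklore] -/
theorem uniformCensus47_subset : ∀ v ∈ uniformCensus47, v ∈ InScopeWinCert.unitCensus81 := by
  decide

/-- … and is disjoint from the plain-undecided 23. [folklore] -/
theorem uniformCensus47_disjoint_plainOpen23 : ∀ v ∈ uniformCensus47, v ∉ plainOpen23 := by
  decide

/-- **47 unit leaves of the census are instances of UNIFORM plain-game theorems over `𝔽₂`** (every booking). [OURS · counted 0 · ‖ K]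
[folklore] -/
theorem stateWins_uniformCensus47 : ∀ v ∈ uniformCensus47, ∀ (r : Fin 4 →₀ ℕ) (exc : Finset (Fin 4)),
    StateWins 2 (⟨monomial (Finsupp.equivFunOnFinite.symm v) 1 * (1 + X 0), r, exc⟩ : State (ZMod 2)) := by
  unfold uniformCensus47
  refine List.forall_mem_cons.mpr ⟨fun r exc => ?_, ?_⟩ -- 1112 (sq3)
  · exact InertSquare.Orbit111.stateWins_unitLeaf_111_sq 1 r exc
  refine List.forall_mem_cons.mpr ⟨fun r exc => ?_, ?_⟩ -- 1121 (sq2)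
  · exact InertSquare.stateWins_unitLeaf_11sq1 1 r exc
  refine List.forall_mem_cons.mpr ⟨fun r exc => ?_, ?_⟩ -- 1122 (one)
  · exact PureLeafNF.stateWins_unitLeaf_oneOdd_partner 1 (by decide) ![1, 1, 2, 2] (by decide) (by decide) (by decide) r exc
  refine List.forall_mem_cons.mpr ⟨fun r exc => ?_, ?_⟩ -- 1211 (sq1)
  · exact InertSquare.stateWins_unitLeaf_1sq11 1 r exc
  refine List.forall_mem_cons.mpr ⟨fun r exc => ?_, ?_⟩ -- 1212 (one)
  · exact PureLeafNF.stateWins_unitLeaf_oneOdd_partner 2 (by decide) ![1, 2, 1, 2] (by decide) (by decide) (by decide) r exc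
  refine List.forall_mem_cons.mpr ⟨fun r exc => ?_, ?_⟩ -- 1221 (one)
  · exact PureLeafNF.stateWins_unitLeaf_oneOdd_partner 3 (by decide) ![1, 2, 2, 1] (by decide) (by decide) (by decide) r exc
  refine List.forall_mem_cons.mpr ⟨fun r exc => ?_, ?_⟩ -- 1222 (pth)
  · exact PureLeafNF.stateWins_unitLeaf_odd_of_forall_even 0 ![1, 2, 2, 2] (by decide) (by decide) r exc
  refine List.forall_mem_cons.mpr ⟨fun r exc => ?_, ?_⟩ -- 1223 (one)
  · exact PureLeafNF.stateWins_unitLeaf_oneOdd_partner 3 (by decide) ![1, 2, 2, 3] (by decide) (by decide) (by decide) r exc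
  refine List.forall_mem_cons.mpr ⟨fun r exc => ?_, ?_⟩ -- 1232 (one)
  · exact PureLeafNF.stateWins_unitLeaf_oneOdd_partner 2 (by decide) ![1, 2, 3, 2] (by decide) (by decide) (by decide) r exc
  refine List.forall_mem_cons.mpr ⟨fun r exc => ?_, ?_⟩ -- 1322 (one)
  · exact PureLeafNF.stateWins_unitLeaf_oneOdd_partner 1 (by decide) ![1, 3, 2, 2] (by decide) (by decide) (by decide) r exc
  refine List.forall_mem_cons.mpr ⟨fun r exc => ?_, ?_⟩ -- 2111 (even)
  · exact PureLeafNF.stateWins_unitLeaf_even 0 ![2, 1, 1, 1] (by decide) r exc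
  refine List.forall_mem_cons.mpr ⟨fun r exc => ?_, ?_⟩ -- 2112 (even)
  · exact PureLeafNF.stateWins_unitLeaf_even 0 ![2, 1, 1, 2] (by decide) r exc
  refine List.forall_mem_cons.mpr ⟨fun r exc => ?_, ?_⟩ -- 2113 (even)
  · exact PureLeafNF.stateWins_unitLeaf_even 0 ![2, 1, 1, 3] (by decide) r exc
  refine List.forall_mem_cons.mpr ⟨fun r exc => ?_, ?_⟩ -- 2121 (even)
  · exact PureLeafNF.stateWins_unitLeaf_even 0 ![2, 1, 2, 1] (by decide) r exc
  refine List.forall_mem_cons.mpr ⟨fun r exc => ?_, ?_⟩ -- 2122 (even)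
  · exact PureLeafNF.stateWins_unitLeaf_even 0 ![2, 1, 2, 2] (by decide) r exc
  refine List.forall_mem_cons.mpr ⟨fun r exc => ?_, ?_⟩ -- 2123 (even)
  · exact PureLeafNF.stateWins_unitLeaf_even 0 ![2, 1, 2, 3] (by decide) r exc
  refine List.forall_mem_cons.mpr ⟨fun r exc => ?_, ?_⟩ -- 2131 (even)
  · exact PureLeafNF.stateWins_unitLeaf_even 0 ![2, 1, 3, 1] (by decide) r exc
  refine List.forall_mem_cons.mpr ⟨fun r exc => ?_, ?_⟩ -- 2132 (even)
  · exact PureLeafNF.stateWins_unitLeaf_even 0 ![2, 1, 3, 2] (by decide) r exc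
  refine List.forall_mem_cons.mpr ⟨fun r exc => ?_, ?_⟩ -- 2133 (even)
  · exact PureLeafNF.stateWins_unitLeaf_even 0 ![2, 1, 3, 3] (by decide) r exc
  refine List.forall_mem_cons.mpr ⟨fun r exc => ?_, ?_⟩ -- 2211 (even)
  · exact PureLeafNF.stateWins_unitLeaf_even 0 ![2, 2, 1, 1] (by decide) r exc
  refine List.forall_mem_cons.mpr ⟨fun r exc => ?_, ?_⟩ -- 2212 (even)
  · exact PureLeafNF.stateWins_unitLeaf_even 0 ![2, 2, 1, 2] (by decide) r exc
  refine List.forall_mem_cons.mpr ⟨fun r exc => ?_, ?_⟩ -- 2213 (even)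
  · exact PureLeafNF.stateWins_unitLeaf_even 0 ![2, 2, 1, 3] (by decide) r exc
  refine List.forall_mem_cons.mpr ⟨fun r exc => ?_, ?_⟩ -- 2221 (even)
  · exact PureLeafNF.stateWins_unitLeaf_even 0 ![2, 2, 2, 1] (by decide) r exc
  refine List.forall_mem_cons.mpr ⟨fun r exc => ?_, ?_⟩ -- 2222 (even)
  · exact PureLeafNF.stateWins_unitLeaf_even 0 ![2, 2, 2, 2] (by decide) r exc
  refine List.forall_mem_cons.mpr ⟨fun r exc => ?_, ?_⟩ -- 2223 (even)
  · exact PureLeafNF.stateWins_unitLeaf_even 0 ![2, 2, 2, 3] (by decide) r exc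
  refine List.forall_mem_cons.mpr ⟨fun r exc => ?_, ?_⟩ -- 2231 (even)
  · exact PureLeafNF.stateWins_unitLeaf_even 0 ![2, 2, 3, 1] (by decide) r exc
  refine List.forall_mem_cons.mpr ⟨fun r exc => ?_, ?_⟩ -- 2232 (even)
  · exact PureLeafNF.stateWins_unitLeaf_even 0 ![2, 2, 3, 2] (by decide) r exc
  refine List.forall_mem_cons.mpr ⟨fun r exc => ?_, ?_⟩ -- 2233 (even)
  · exact PureLeafNF.stateWins_unitLeaf_even 0 ![2, 2, 3, 3] (by decide) r exc
  refine List.forall_mem_cons.mpr ⟨fun r exc => ?_, ?_⟩ -- 2311 (even)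
  · exact PureLeafNF.stateWins_unitLeaf_even 0 ![2, 3, 1, 1] (by decide) r exc
  refine List.forall_mem_cons.mpr ⟨fun r exc => ?_, ?_⟩ -- 2312 (even)
  · exact PureLeafNF.stateWins_unitLeaf_even 0 ![2, 3, 1, 2] (by decide) r exc
  refine List.forall_mem_cons.mpr ⟨fun r exc => ?_, ?_⟩ -- 2313 (even)
  · exact PureLeafNF.stateWins_unitLeaf_even 0 ![2, 3, 1, 3] (by decide) r exc
  refine List.forall_mem_cons.mpr ⟨fun r exc => ?_, ?_⟩ -- 2321 (even)
  · exact PureLeafNF.stateWins_unitLeaf_even 0 ![2, 3, 2, 1] (by decide) r exc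
  refine List.forall_mem_cons.mpr ⟨fun r exc => ?_, ?_⟩ -- 2322 (even)
  · exact PureLeafNF.stateWins_unitLeaf_even 0 ![2, 3, 2, 2] (by decide) r exc
  refine List.forall_mem_cons.mpr ⟨fun r exc => ?_, ?_⟩ -- 2323 (even)
  · exact PureLeafNF.stateWins_unitLeaf_even 0 ![2, 3, 2, 3] (by decide) r exc
  refine List.forall_mem_cons.mpr ⟨fun r exc => ?_, ?_⟩ -- 2331 (even)
  · exact PureLeafNF.stateWins_unitLeaf_even 0 ![2, 3, 3, 1] (by decide) r exc
  refine List.forall_mem_cons.mpr ⟨fun r exc => ?_, ?_⟩ -- 2332 (even)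
  · exact PureLeafNF.stateWins_unitLeaf_even 0 ![2, 3, 3, 2] (by decide) r exc
  refine List.forall_mem_cons.mpr ⟨fun r exc => ?_, ?_⟩ -- 2333 (even)
  · exact PureLeafNF.stateWins_unitLeaf_even 0 ![2, 3, 3, 3] (by decide) r exc
  refine List.forall_mem_cons.mpr ⟨fun r exc => ?_, ?_⟩ -- 3112 (sq3)
  · exact InertSquare.Orbit311.stateWins_unitLeaf_311_sq 1 r exc
  refine List.forall_mem_cons.mpr ⟨fun r exc => ?_, ?_⟩ -- 3121 (sq2)
  · exact InertSquare.stateWins_unitLeaf_31sq1 1 r exc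
  refine List.forall_mem_cons.mpr ⟨fun r exc => ?_, ?_⟩ -- 3122 (three)
  · exact PureLeafNF.stateWins_unitLeaf_threeOdd_partner 1 (by decide) ![3, 1, 2, 2] (by decide) (by decide) (by decide) r exc
  refine List.forall_mem_cons.mpr ⟨fun r exc => ?_, ?_⟩ -- 3211 (sq1)
  · exact InertSquare.stateWins_unitLeaf_3sq11 1 r exc
  refine List.forall_mem_cons.mpr ⟨fun r exc => ?_, ?_⟩ -- 3212 (three)
  · exact PureLeafNF.stateWins_unitLeaf_threeOdd_partner 2 (by decide) ![3, 2, 1, 2] (by decide) (by decide) (by decide) r exc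
  refine List.forall_mem_cons.mpr ⟨fun r exc => ?_, ?_⟩ -- 3221 (three)
  · exact PureLeafNF.stateWins_unitLeaf_threeOdd_partner 3 (by decide) ![3, 2, 2, 1] (by decide) (by decide) (by decide) r exc
  refine List.forall_mem_cons.mpr ⟨fun r exc => ?_, ?_⟩ -- 3222 (pth)
  · exact PureLeafNF.stateWins_unitLeaf_odd_of_forall_even 0 ![3, 2, 2, 2] (by decide) (by decide) r exc
  refine List.forall_mem_cons.mpr ⟨fun r exc => ?_, ?_⟩ -- 3223 (three)
  · exact PureLeafNF.stateWins_unitLeaf_threeOdd_partner 3 (by decide) ![3, 2, 2, 3] (by decide) (by decide) (by decide) r exc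
  refine List.forall_mem_cons.mpr ⟨fun r exc => ?_, ?_⟩ -- 3232 (three)
  · exact PureLeafNF.stateWins_unitLeaf_threeOdd_partner 2 (by decide) ![3, 2, 3, 2] (by decide) (by decide) (by decide) r exc
  refine List.forall_mem_cons.mpr ⟨fun r exc => ?_, ?_⟩ -- 3322 (three)
  · exact PureLeafNF.stateWins_unitLeaf_threeOdd_partner 1 (by decide) ![3, 3, 2, 2] (by decide) (by decide) (by decide) r exc
  exact List.forall_mem_nil _

end UnitLeafPlain

end Summit.ResolutionOfSingularities.ResolutionOfSingularities.Theorems.PIDim4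

end
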